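import Literature.Analysis.FluidPDE.SereginSlabLayer
import Literature.Analysis.FluidPDE.NSSereginBlowupCore
import HarnessLib

/-!
# Seregin's `L³` blow-up criterion: the discharges of `seregin_regular_of_liminf_L3`,
# `seregin_L3_blowup_mild` (Lemarié-Rieusset 2016, Thm. 15.5), `seregin_L3_blowup` (ns.S08)
# and `seregin_L3_blowup_energy` (Seregin 2012, Thm. 1.1 as printed)

Analysis/FluidPDE proof file (theorems only: no definition, no named fact, no `sorry`).
The accepted `NSSereginBlowupCore.lean` proves Seregin's theorem along Seregin's own
architecture (G. Seregin, Comm. Math. Phys. 312 (2012) = arXiv:1104.3615, §§2–4: nothing beyond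
the blow-up time; no existence theory of local Leray solutions, no weak–strong uniqueness) in its
three tree forms conditionally on the slab initial layer `hSlab`
(`seregin_regular_of_liminf_L3_of_slabLayer`, `seregin_L3_blowup_mild_of_slabLayer`,
`seregin_L3_blowup_of_slabLayer`); `SereginSlabLayer.lean` proves `hSlab` (`seregin_slabLayer`).
This file records the four discharges, each a one-line application:
`seregin_regular_of_liminf_L3_holds`, `seregin_L3_blowup_mild_holds`, `seregin_L3_blowup_holds`,
and `seregin_L3_blowup_energy_holds` (through `seregin_L3_blowup_energy_of_liminf_L3`,
`NSLerayHopfSereginAssembly.lean`). Statements unchanged.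

## References

* G. Seregin, Comm. Math. Phys. 312 (2012) 833–845 = arXiv:1104.3615, Thm. 1.1, §§2–4.
  [`Seregin2012CMP`]
* P. G. Lemarié-Rieusset, *The Navier–Stokes Problem in the 21st Century* (CRC 2016),
  doi:10.1201/b19556, Thm. 15.5 (PDF p. 570, proof pp. 570–573). [`LemarieRieusset2016`]
* H. Jia, V. Šverák, SIAM J. Math. Anal. 45 (2013) = arXiv:1201.1592, Lemma 8. [`JiaSverak2013`]
-/

noncomputable section

open MeasureTheory TopologicalSpace Set Function Filter Metric
open _root_.Topology
open scoped ENNReal NNReal RealInnerProductSpace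

namespace Literature.Analysis.FluidPDE

/-! ## The four discharges -/

/-- **Discharge of `seregin_regular_of_liminf_L3`** (Seregin's theorem, core form: a Kato
solution on `[0, T)` with `liminf_{t↑T} ‖u(t)‖₃ < ∞` is essentially bounded on some
`Q_r(T, x₀)` at every `x₀`; Seregin 2012, Thm. 1.1, §§2–4 = Lemarié-Rieusset 2016, proof of
Thm. 15.5, pp. 570–573): `seregin_regular_of_liminf_L3_of_slabLayer` (`NSSereginBlowupCore.lean`)
with `seregin_slabLayer`. [cite: Seregin2012CMP, Thm. 1.1, §§2–4] [cite: LemarieRieusset2016, Thm. 15.5, proof pp. 570–573] -/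
theorem seregin_regular_of_liminf_L3_holds : seregin_regular_of_liminf_L3 :=
  seregin_regular_of_liminf_L3_of_slabLayer seregin_slabLayer

/-- **Discharge of `seregin_L3_blowup_mild`** (Lemarié-Rieusset 2016, **Thm. 15.5** "Seregin's
theorem", PDF p. 570 of doi:10.1201/b19556: the mild solution in `C([0,T*), L³)` with divergence
free datum `u₀ ∈ L³` and finite maximal time `T*` has `‖u(t)‖₃ → ∞` as `t → T*`):
`seregin_L3_blowup_mild_of_slabLayer` with `seregin_slabLayer`.
[cite: LemarieRieusset2016, Thm. 15.5 (PDF p. 570; proof pp. 570–573)] [cite: Seregin2012CMP, Thm. 1.1] -/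
theorem seregin_L3_blowup_mild_holds : seregin_L3_blowup_mild :=
  seregin_L3_blowup_mild_of_slabLayer seregin_slabLayer

/-- **Discharge of `seregin_L3_blowup`** (problem sheet ns.S08; Seregin 2012, Thm. 1.1 in the
tree's maximal-smooth form): `seregin_L3_blowup_of_slabLayer` with `seregin_slabLayer`.
[cite: Seregin2012CMP, Thm. 1.1] [cite: LemarieRieusset2016, Thm. 15.5] -/
theorem seregin_L3_blowup_holds : seregin_L3_blowup :=
  seregin_L3_blowup_of_slabLayer seregin_slabLayer

/-- **Discharge of `seregin_L3_blowup_energy`** (Seregin 2012, Comm. Math. Phys. 312, Thm. 1.1,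
as printed: an energy solution from `a ∈ C^∞_{0,0}(ℝ³)` with finite blow-up time `T` has
`‖v(·,t)‖₃ → ∞` as `t ↑ T`): `seregin_L3_blowup_energy_of_liminf_L3`
(`NSLerayHopfSereginAssembly.lean`) with `seregin_regular_of_liminf_L3_holds`.
[cite: Seregin2012CMP, Thm. 1.1] -/
theorem seregin_L3_blowup_energy_holds : seregin_L3_blowup_energy :=
  seregin_L3_blowup_energy_of_liminf_L3 seregin_regular_of_liminf_L3_holds

end Literature.Analysis.FluidPDE

end
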